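import Summits.AtomisticToContinuum.BoseEinsteinCondensation.Theorems.HardCoreExtension.Negative.ScalingReductions

/-!
# `HardCoreExtension` (stmt-AtomisticToContinuum-11786): normal form of the uniform repair of the
antecedent, and finite energy at low density (negative lane, gen 2, third file)

* `uniformSmoothBEC_iff_unitRange` — the refuters' `(a, R)`-UNIFORM repair of the antecedent
  ("one `ρ₀, c, N₀` for all smooth-class `v` with `𝔞(v) ≤ a` and range `≤ R`") is equivalent to its
  `R = 1` slice indexed by `α = a/R ∈ (0, 1]` (dilate by `1/R`: `condensateNumber` is dilation invariant
  at the level of each `N`, `JelliumBoseGas.condensateNumber_dilate`; `𝔞` scales like a length,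
  `scatteringLength_scalePotential`). So the repair has ONE genuine parameter.
* `finiteEnergyAtLowDensity` — the support hypothesis `FiniteEnergyAtLowDensity` of the round-1 line
  `near-minimiser-slack-transfer` HOLDS for every repulsive finite-range `v` (hard cores included):
  `E₀^D(N, L_N) < ∞` eventually for `ρ < (1+R)⁻³` (tree: `limsup_lt_top_of_small`).

Nothing here asserts a Theses decl.
-/

namespace Summit.AtomisticToContinuum.BoseEinsteinCondensation.Theorems.HardCoreExtension.Negative

open MeasureTheory Filter Metric
open scoped ENNReal Topology
open Literature.MathematicalPhysics.QuantumManyBody.BoseGas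
open Literature.MathematicalPhysics.QuantumManyBody (JelliumBoseGas.sideLength_div_pow_three
  JelliumBoseGas.condensateNumber_dilate)

noncomputable section

/-- `condensateNumber` along the thermodynamic box sequence is dilation covariant at EACH `N`:
`condensateNumber (s⁻²v(·/s)) N (L_N(ρ/s³)) = condensateNumber v N (L_N(ρ))`. [cite: LSSY2005, Ch. 5, footnote to (5.3)] -/
theorem condensateNumber_scalePotential_sideLength (v : ℝ → ℝ≥0∞) {s ρ : ℝ} (hs : 0 < s) (hρ : 0 < ρ)
    (N : ℕ) :
    condensateNumber (scalePotential s v) N (sideLength (ρ / s ^ 3) N) =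
      condensateNumber v N (sideLength ρ N) := by
  rw [JelliumBoseGas.sideLength_div_pow_three hρ hs, JelliumBoseGas.condensateNumber_dilate v _ _ hs]

/-- **The `(a, R)`-uniform repair of the antecedent is its unit-range slice.** Uniform smooth-class BEC
with constants depending on `v` only through a bound `a` on `𝔞(v)` and a bound `R` on the range holds for
all `0 < a ≤ R` iff it holds for `R = 1` and all `α = a ∈ (0, 1]` (then `ρ₀(a, R) = ρ₀(a/R, 1)/R³`, same
`c`, same `N₀`). [folklore] -/
theorem uniformSmoothBEC_iff_unitRange :
    (∀ a R : ℝ, 0 < a → a ≤ R → ∃ ρ₀ : ℝ, 0 < ρ₀ ∧ ∀ ρ : ℝ, 0 < ρ → ρ < ρ₀ →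
        ∃ c : ℝ, 0 < c ∧ ∃ N₀ : ℕ, ∀ v : ℝ → ℝ≥0∞, IsRepulsiveFiniteRange v → (∀ r, v r ≠ ⊤) →
          ContDiff ℝ 2 (fun x : Space => (v ‖x‖).toReal) →
          (∃ Cₑ : ℝ, ∀ x : Space, ‖iteratedFDeriv ℝ 2 (fun x : Space => (v ‖x‖).toReal) x‖ ≤
              Cₑ * Real.sqrt ((v ‖x‖).toReal)) →
          scatteringLength v ≤ ENNReal.ofReal a → (∀ r, R < r → v r = 0) →
          ∀ N : ℕ, N₀ ≤ N → ENNReal.ofReal (c * N) ≤ condensateNumber v N (sideLength ρ N)) ↔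
      ∀ a : ℝ, 0 < a → a ≤ 1 → ∃ ρ₀ : ℝ, 0 < ρ₀ ∧ ∀ ρ : ℝ, 0 < ρ → ρ < ρ₀ →
        ∃ c : ℝ, 0 < c ∧ ∃ N₀ : ℕ, ∀ v : ℝ → ℝ≥0∞, IsRepulsiveFiniteRange v → (∀ r, v r ≠ ⊤) →
          ContDiff ℝ 2 (fun x : Space => (v ‖x‖).toReal) →
          (∃ Cₑ : ℝ, ∀ x : Space, ‖iteratedFDeriv ℝ 2 (fun x : Space => (v ‖x‖).toReal) x‖ ≤
              Cₑ * Real.sqrt ((v ‖x‖).toReal)) →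
          scatteringLength v ≤ ENNReal.ofReal a → (∀ r, 1 < r → v r = 0) →
          ∀ N : ℕ, N₀ ≤ N → ENNReal.ofReal (c * N) ≤ condensateNumber v N (sideLength ρ N) := by
  refine ⟨fun h a ha ha1 => h a 1 ha ha1, fun h a R ha haR => ?_⟩
  have hR : 0 < R := ha.trans_le haR
  have hα : 0 < a / R := div_pos ha hR
  have hα1 : a / R ≤ 1 := (div_le_one hR).2 haR
  obtain ⟨ρ₀, hρ₀, hρ⟩ := h (a / R) hα hα1
  have hR3 : 0 < R ^ 3 := by positivity
  refine ⟨ρ₀ / R ^ 3, by positivity, fun ρ hρpos hρlt => ?_⟩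
  -- the scaled density `ρ R³ < ρ₀`
  have hρ' : ρ * R ^ 3 < ρ₀ := by rwa [lt_div_iff₀ hR3] at hρlt
  obtain ⟨c, hc, N₀, hN⟩ := hρ (ρ * R ^ 3) (by positivity) hρ'
  refine ⟨c, hc, N₀, fun v hv hfin hC hedge hav hvR N hN₀ => ?_⟩
  have hs : 0 < R⁻¹ := inv_pos.2 hR
  -- the dilated potential `R² v(R ·)` is a unit-range member of the class with `𝔞 ≤ a/R`
  have hunit : ∀ r, 1 < r → scalePotential R⁻¹ v r = 0 := by
    intro r hr
    refine scalePotential_eq_zero_of_lt hvR hs r ?_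
    rwa [inv_mul_cancel₀ hR.ne']
  have ha' : scatteringLength (scalePotential R⁻¹ v) ≤ ENNReal.ofReal (a / R) := by
    rw [scatteringLength_scalePotential v hs, div_eq_inv_mul, ENNReal.ofReal_mul (inv_nonneg.2 hR.le)]
    exact mul_le_mul_right hav _
  have key := hN _ (isRepulsiveFiniteRange_scalePotential hv hs) (scalePotential_ne_top hfin _)
    (contDiff_scalePotential_profile hC hs) (edgeCondition_scalePotential hC hedge hs) ha' hunit N hN₀
  -- undo the dilation: density `ρ R³ = ρ / (R⁻¹)³`
  have hρeq : ρ * R ^ 3 = ρ / R⁻¹ ^ 3 := by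
    rw [inv_pow, div_inv_eq_mul]
  rwa [hρeq, condensateNumber_scalePotential_sideLength v hs hρpos] at key

/-- **Finite energy at low density** (the support hypothesis `FiniteEnergyAtLowDensity` of card
`near-minimiser-slack-transfer`, spelled out): every repulsive finite-range `v` (hard cores included)
has `0 < L_N` and `E₀^D(N, L_N) ≠ ⊤` eventually along `L_N = (N/ρ)^{1/3}`, for `ρ < (1+R)⁻³` with `R` a
positive range of `v` (free-volume product states; tree `limsup_lt_top_of_small`). [folklore] -/
theorem finiteEnergyAtLowDensity (v : ℝ → ℝ≥0∞) (hv : IsRepulsiveFiniteRange v) :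
    ∃ ρ₀ : ℝ, 0 < ρ₀ ∧ ∀ ρ : ℝ, 0 < ρ → ρ < ρ₀ →
      ∀ᶠ N : ℕ in atTop, 0 < sideLength ρ N ∧ groundStateEnergy v N (sideLength ρ N) ≠ ⊤ := by
  obtain ⟨R, hR, hvR⟩ := hv.exists_pos_range
  have hR3 : 0 < (1 + R) ^ 3 := by positivity
  refine ⟨((1 + R) ^ 3)⁻¹, by positivity, fun ρ hρ hlt => ?_⟩
  have hsmall : ρ * (1 + R) ^ 3 < 1 := by
    have := mul_lt_mul_of_pos_right hlt hR3
    rwa [inv_mul_cancel₀ hR3.ne'] at this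
  have hlim := limsup_lt_top_of_small hv.1 hvR hR hρ hsmall
  have hev : ∀ᶠ N : ℕ in atTop, energyPerParticleDirichlet v ρ N < ⊤ :=
    Filter.eventually_lt_of_limsup_lt hlim
  filter_upwards [hev, eventually_gt_atTop 0] with N hN hN0
  refine ⟨sideLength_pos_of_pos hρ hN0, fun htop => ?_⟩
  unfold energyPerParticleDirichlet at hN
  rw [htop, ENNReal.top_div_of_ne_top (ENNReal.natCast_ne_top N)] at hN
  exact lt_irrefl _ hN

end

end Summit.AtomisticToContinuum.BoseEinsteinCondensation.Theorems.HardCoreExtension.Negative
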